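import Summits.NavierStokesRegularity.NavierStokesRegularity.Theorems.PoloidalWindowDoorPoloidalWindowRigidityZShockNoLocalizedBreatherTools
import HarnessLib

/-!
# Crux K2 `PoloidalWindowRigidity` (stmt-NavierStokesRegularity-19708), line `z_shock` — breather door, quantitative side: a non-frozen height-periodic
# pattern RADIATES — its period-averaged horizontal energy in the ball of radius `a' + 2N + 1` exceeds a harmonic number `H_N` times its defect

`--supports stmt-NavierStokesRegularity-19708 --as helper` (leafhand-ns-poloidalwindowdoor-3 g11, cell decomp-ns, 2026-08-31).  Def-free; sequel of
`…ZShockBreatherBound` (p833514) and `…ZShockNoLocalizedBreatherTools` (p833601).  **No stub and no summit is closed by this file; Navier–Stokes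
regularity is NOT proved here (rung 0).**

For a jointly smooth, `P`-periodic-in-height solution of the autonomous height-evolution on a uniformly hyperbolic column (`−γhi ≤ G ≤ −γlo`,
`Θ(w⋆) = 0`, `Θ' = (· − w⋆)G`), write `J(a') = ∫₀ᴾ∫ χ_{a'} γlo (w − w⋆)²` (the cut-off defect about the level `w⋆`) and
`K = ³⁄₂|u|² + (γhi/2)(w − w⋆)²` (the energy density of the shell term).

* `defect_le_shell` — for `0 ≤ a' ≤ a`: `J(a') ≤ L(a+1)·∫₀ᴾ∫ (χ_{a+1} − χ_{a−1}) K` (breather bound + shell domination + monotonicity in the radius;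
  `L` the slope bound of the cutoff profile);
* ★ `ball_energy_ge_harmonic` — for every `N`:  `(J(a')/(L(a'+2)))·Σ_{k<N} 1/(k+1) ≤ ∫₀ᴾ∫ χ_{a'+2N} K`.
  Since `Σ_{k<N} 1/(k+1) ≥ log(N+1)`, a pattern with a non-zero defect in some ball (`J(a') > 0`, i.e. not frozen there) has period-averaged
  horizontal energy growing at least LOGARITHMICALLY with the radius: it radiates.  (The rotating Bessel witness of the linear column,
  `…ZShockRotatingProfileLinearWitness`, radiates linearly: amplitude `≍ r^{-1/2}`.)  With `∫ K < ∞` one recovers `J ≡ 0`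
  (`…ZShockNoLocalizedBreather`).

Reading for the line: the quantitative form of «kinematic R3 inhabitants must radiate» for the TwoFamilyBreakdown / rotating-pattern programme
(hands 3-g9, 3-g10): any θ-periodic-in-height candidate has at least logarithmically divergent horizontal energy. [folklore]
-/

noncomputable section

namespace Summit.NavierStokesRegularity.NavierStokesRegularity.Theorems.PoloidalWindowDoorPoloidalWindowRigidityZShockBreatherRadiation

-- the summit and its single sub-problem share the name (CONVENTIONS §1)
set_option linter.dupNamespace false

open Set Filter Topology Function MeasureTheory Metric
open scoped ContDiff
open Summit.NavierStokesRegularity.NavierStokesRegularity.Theorems.PoloidalWindowDoorPoloidalWindowRigidityZShockVirialLaw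
open Summit.NavierStokesRegularity.NavierStokesRegularity.Theorems.PoloidalWindowDoorPoloidalWindowRigidityZShockLocalEnergyCutoff
open Summit.NavierStokesRegularity.NavierStokesRegularity.Theorems.PoloidalWindowDoorPoloidalWindowRigidityZShockLocalEnergy
open Summit.NavierStokesRegularity.NavierStokesRegularity.Theorems.PoloidalWindowDoorPoloidalWindowRigidityZShockPeriodicVirial
open Summit.NavierStokesRegularity.NavierStokesRegularity.Theorems.PoloidalWindowDoorPoloidalWindowRigidityZShockBreatherBound
open Summit.NavierStokesRegularity.NavierStokesRegularity.Theorems.PoloidalWindowDoorPoloidalWindowRigidityZShockNoLocalizedBreatherTools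

variable {u : Fin 2 → ℝ → EuclideanSpace ℝ (Fin 2) → ℝ} {w : ℝ → EuclideanSpace ℝ (Fin 2) → ℝ} {G Θ : ℝ → ℝ}
  {wstar P γlo γhi L : ℝ}

/-- **Defect inside radius `a'` is paid by the shell at any larger radius `a`.** [folklore] -/
theorem defect_le_shell (hu : ∀ i, ContDiff ℝ ∞ (uncurry (u i))) (hw : ContDiff ℝ ∞ (uncurry w))
    (hΘs : ContDiff ℝ ∞ Θ) (hΘ : ∀ r, HasDerivAt Θ ((r - wstar) * G r) r) (hΘ0 : Θ wstar = 0)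
    (hγlo : 0 ≤ γlo) (hGlo : ∀ r, G r ≤ -γlo) (hGhi : ∀ r, -γhi ≤ G r)
    (hus : ∀ i s y, HasDerivAt (fun s' => u i s' y) (G (w s y) * fderiv ℝ (w s) y (EuclideanSpace.single i 1)) s)
    (hws : ∀ s y, HasDerivAt (fun s' => w s' y)
      (-(fderiv ℝ (u 0 s) y (EuclideanSpace.single 0 1) + fderiv ℝ (u 1 s) y (EuclideanSpace.single 1 1))) s)
    (hpol : ∀ s y, fderiv ℝ (u 0 s) y (EuclideanSpace.single 1 1) = fderiv ℝ (u 1 s) y (EuclideanSpace.single 0 1))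
    (hP : 0 ≤ P) (hPu : ∀ i s y, u i (s + P) y = u i s y) (hPw : ∀ s y, w (s + P) y = w s y)
    (hL0 : 0 ≤ L) (hL : ∀ b t : ℝ, |deriv (fun v : ℝ => Real.smoothTransition (b - v)) t| ≤ L)
    {a' a : ℝ} (ha' : 0 ≤ a') (haa : a' ≤ a) :
    ∫ s in (0 : ℝ)..P, ∫ y : EuclideanSpace ℝ (Fin 2), Real.smoothTransition (a' + 1 - √(1 + ‖y‖ ^ 2)) * (γlo * (w s y - wstar) ^ 2) ≤
      L * (a + 1) * ∫ s in (0 : ℝ)..P, ∫ y : EuclideanSpace ℝ (Fin 2),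
        (Real.smoothTransition (a + 2 - √(1 + ‖y‖ ^ 2)) - Real.smoothTransition (a - √(1 + ‖y‖ ^ 2))) *
          ((3 / 2) * (u 0 s y ^ 2 + u 1 s y ^ 2) + (γhi / 2) * (w s y - wstar) ^ 2) := by
  have ha : 0 ≤ a := ha'.trans haa
  have hγhi : 0 ≤ γhi := by linarith [hGlo 0, hGhi 0]
  set K : ℝ → EuclideanSpace ℝ (Fin 2) → ℝ := fun s y =>
    (3 / 2) * (u 0 s y ^ 2 + u 1 s y ^ 2) + (γhi / 2) * (w s y - wstar) ^ 2 with hK_def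
  set Dd : ℝ → EuclideanSpace ℝ (Fin 2) → ℝ := fun s y => γlo * (w s y - wstar) ^ 2 with hDd_def
  have hu2 : ContDiff ℝ ∞ (uncurry fun s (y : EuclideanSpace ℝ (Fin 2)) => u 0 s y ^ 2 + u 1 s y ^ 2) :=
    ((hu 0).pow 2).add ((hu 1).pow 2)
  have hd2 : ContDiff ℝ ∞ (uncurry fun s (y : EuclideanSpace ℝ (Fin 2)) => (w s y - wstar) ^ 2) :=
    (hw.sub contDiff_const).pow 2
  have hKc : Continuous (uncurry K) := (continuous_const.mul hu2.continuous).add (continuous_const.mul hd2.continuous)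
  have hDdc : Continuous (uncurry Dd) := continuous_const.mul hd2.continuous
  have hK0 : ∀ s y, 0 ≤ K s y := fun s y => by simp only [hK_def]; positivity
  have hDd0 : ∀ s y, 0 ≤ Dd s y := fun s y => by simp only [hDd_def]; positivity
  -- monotonicity in the radius
  have hJc : ∀ b, Continuous fun s => ∫ y, Real.smoothTransition (b + 1 - √(1 + ‖y‖ ^ 2)) * Dd s y := fun b =>
    continuous_weighted hDdc (continuous_cutoff b) (cutoff_zero_of_lt b)
  have hmono : ∫ s in (0 : ℝ)..P, ∫ y, Real.smoothTransition (a' + 1 - √(1 + ‖y‖ ^ 2)) * Dd s y ≤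
      ∫ s in (0 : ℝ)..P, ∫ y, Real.smoothTransition (a + 1 - √(1 + ‖y‖ ^ 2)) * Dd s y := by
    refine intervalIntegral.integral_mono_on hP ((hJc a').intervalIntegrable _ _) ((hJc a).intervalIntegrable _ _) fun s _ => ?_
    refine integral_mono (integrable_weighted hDdc (continuous_cutoff a') (cutoff_zero_of_lt a') s)
      (integrable_weighted hDdc (continuous_cutoff a) (cutoff_zero_of_lt a) s) fun y => ?_
    exact mul_le_mul_of_nonneg_right (Real.smoothTransition.monotone (by linarith)) (hDd0 s y)
  -- the breather bound at radius `a` and the shell domination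
  have hPV := periodic_virial_le hu hw hΘs hΘ hΘ0 hγlo hGlo hGhi hus hws hpol hP hPu hPw a
  simp only [zero_mul, add_zero] at hPV
  have hρc : Continuous fun y : EuclideanSpace ℝ (Fin 2) =>
      Real.smoothTransition (a + 2 - √(1 + ‖y‖ ^ 2)) - Real.smoothTransition (a - √(1 + ‖y‖ ^ 2)) := by
    have h1 := continuous_cutoff (a + 1)
    have h2 := continuous_cutoff (a - 1)
    simp only [sub_add_cancel] at h2
    exact (h1.congr fun y => by ring_nf).sub h2
  have hρ0 : ∀ y : EuclideanSpace ℝ (Fin 2), a + 2 < ‖y‖ →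
      Real.smoothTransition (a + 2 - √(1 + ‖y‖ ^ 2)) - Real.smoothTransition (a - √(1 + ‖y‖ ^ 2)) = 0 := by
    intro y hy
    have hb := norm_le_bracket y
    rw [Real.smoothTransition.zero_of_nonpos (by linarith), Real.smoothTransition.zero_of_nonpos (by linarith), sub_zero]
  have hσc : Continuous fun y : EuclideanSpace ℝ (Fin 2) =>
      |deriv (fun v : ℝ => Real.smoothTransition (a + 1 - v)) (√(1 + ‖y‖ ^ 2))| * √(1 + ‖y‖ ^ 2) := by
    have h := continuous_deriv_cutoff (n := 2) a 0 0
    simp only [mul_zero, add_zero] at h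
    exact h.abs.mul (contDiff_bracket (k := 0)).continuous
  have hσ0 : ∀ y : EuclideanSpace ℝ (Fin 2), a + 1 < ‖y‖ →
      |deriv (fun v : ℝ => Real.smoothTransition (a + 1 - v)) (√(1 + ‖y‖ ^ 2))| * √(1 + ‖y‖ ^ 2) = 0 := by
    intro y hy
    rw [deriv_profile_eq_zero (by linarith [norm_le_bracket y]), abs_zero, zero_mul]
  have hRle : ∀ s, ∫ y, |deriv (fun v : ℝ => Real.smoothTransition (a + 1 - v)) (√(1 + ‖y‖ ^ 2))| *
        (√(1 + ‖y‖ ^ 2) * K s y) ≤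
      L * (a + 1) * ∫ y, (Real.smoothTransition (a + 2 - √(1 + ‖y‖ ^ 2)) - Real.smoothTransition (a - √(1 + ‖y‖ ^ 2))) * K s y := by
    intro s
    rw [← integral_const_mul]
    have hi1 := integrable_weighted hKc hσc hσ0 s
    have hi2 := (integrable_weighted hKc hρc hρ0 s).const_mul (L * (a + 1))
    refine integral_mono (hi1.congr (Eventually.of_forall fun y => by simp only; ring)) hi2 fun y => ?_
    have hdom := abs_deriv_profile_mul_le hL0 hL ha (bracket_pos y).le
    have hk := hK0 s y
    calc |deriv (fun v : ℝ => Real.smoothTransition (a + 1 - v)) (√(1 + ‖y‖ ^ 2))| * (√(1 + ‖y‖ ^ 2) * K s y)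
        = (|deriv (fun v : ℝ => Real.smoothTransition (a + 1 - v)) (√(1 + ‖y‖ ^ 2))| * √(1 + ‖y‖ ^ 2)) * K s y := by ring
      _ ≤ (L * (a + 1) * (Real.smoothTransition (a + 2 - √(1 + ‖y‖ ^ 2)) - Real.smoothTransition (a - √(1 + ‖y‖ ^ 2)))) * K s y :=
          mul_le_mul_of_nonneg_right hdom hk
      _ = L * (a + 1) * ((Real.smoothTransition (a + 2 - √(1 + ‖y‖ ^ 2)) - Real.smoothTransition (a - √(1 + ‖y‖ ^ 2))) * K s y) := by
          ring
  have hRc : Continuous fun s => ∫ y, |deriv (fun v : ℝ => Real.smoothTransition (a + 1 - v)) (√(1 + ‖y‖ ^ 2))| *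
      (√(1 + ‖y‖ ^ 2) * K s y) := by
    have h := continuous_weighted hKc hσc hσ0
    refine h.congr fun s => integral_congr_ae (Eventually.of_forall fun y => ?_)
    simp only; ring
  have hHc : Continuous fun s => ∫ y, (Real.smoothTransition (a + 2 - √(1 + ‖y‖ ^ 2)) -
      Real.smoothTransition (a - √(1 + ‖y‖ ^ 2))) * K s y := continuous_weighted hKc hρc hρ0
  calc ∫ s in (0 : ℝ)..P, ∫ y, Real.smoothTransition (a' + 1 - √(1 + ‖y‖ ^ 2)) * Dd s y
      ≤ ∫ s in (0 : ℝ)..P, ∫ y, Real.smoothTransition (a + 1 - √(1 + ‖y‖ ^ 2)) * Dd s y := hmono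
    _ ≤ ∫ s in (0 : ℝ)..P, ∫ y, |deriv (fun v : ℝ => Real.smoothTransition (a + 1 - v)) (√(1 + ‖y‖ ^ 2))| *
          (√(1 + ‖y‖ ^ 2) * K s y) := hPV
    _ ≤ ∫ s in (0 : ℝ)..P, L * (a + 1) * ∫ y, (Real.smoothTransition (a + 2 - √(1 + ‖y‖ ^ 2)) -
          Real.smoothTransition (a - √(1 + ‖y‖ ^ 2))) * K s y :=
        intervalIntegral.integral_mono_on hP (hRc.intervalIntegrable _ _) ((hHc.const_mul _).intervalIntegrable _ _) fun s _ => hRle s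
    _ = L * (a + 1) * ∫ s in (0 : ℝ)..P, ∫ y, (Real.smoothTransition (a + 2 - √(1 + ‖y‖ ^ 2)) -
          Real.smoothTransition (a - √(1 + ‖y‖ ^ 2))) * K s y := intervalIntegral.integral_const_mul _ _

/-- ★ **Radiation lower bound**: the period-averaged energy in the ball of radius `a' + 2N + 1` exceeds the harmonic number `Σ_{k<N} 1/(k+1)` times
`J(a')/(L(a'+2))`. [folklore] -/
theorem ball_energy_ge_harmonic (hu : ∀ i, ContDiff ℝ ∞ (uncurry (u i))) (hw : ContDiff ℝ ∞ (uncurry w))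
    (hΘs : ContDiff ℝ ∞ Θ) (hΘ : ∀ r, HasDerivAt Θ ((r - wstar) * G r) r) (hΘ0 : Θ wstar = 0)
    (hγlo : 0 ≤ γlo) (hGlo : ∀ r, G r ≤ -γlo) (hGhi : ∀ r, -γhi ≤ G r)
    (hus : ∀ i s y, HasDerivAt (fun s' => u i s' y) (G (w s y) * fderiv ℝ (w s) y (EuclideanSpace.single i 1)) s)
    (hws : ∀ s y, HasDerivAt (fun s' => w s' y)
      (-(fderiv ℝ (u 0 s) y (EuclideanSpace.single 0 1) + fderiv ℝ (u 1 s) y (EuclideanSpace.single 1 1))) s)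
    (hpol : ∀ s y, fderiv ℝ (u 0 s) y (EuclideanSpace.single 1 1) = fderiv ℝ (u 1 s) y (EuclideanSpace.single 0 1))
    (hP : 0 ≤ P) (hPu : ∀ i s y, u i (s + P) y = u i s y) (hPw : ∀ s y, w (s + P) y = w s y)
    (hL0 : 0 < L) (hL : ∀ b t : ℝ, |deriv (fun v : ℝ => Real.smoothTransition (b - v)) t| ≤ L)
    {a' : ℝ} (ha' : 0 ≤ a') (N : ℕ) :
    (∫ s in (0 : ℝ)..P, ∫ y : EuclideanSpace ℝ (Fin 2), Real.smoothTransition (a' + 1 - √(1 + ‖y‖ ^ 2)) * (γlo * (w s y - wstar) ^ 2))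
        / (L * (a' + 2)) * ∑ k ∈ Finset.range N, (1 / ((k : ℝ) + 1)) ≤
      ∫ s in (0 : ℝ)..P, ∫ y : EuclideanSpace ℝ (Fin 2), Real.smoothTransition (a' + 2 * N + 1 - √(1 + ‖y‖ ^ 2)) *
        ((3 / 2) * (u 0 s y ^ 2 + u 1 s y ^ 2) + (γhi / 2) * (w s y - wstar) ^ 2) := by
  have hγhi : 0 ≤ γhi := by linarith [hGlo 0, hGhi 0]
  set K : ℝ → EuclideanSpace ℝ (Fin 2) → ℝ := fun s y =>
    (3 / 2) * (u 0 s y ^ 2 + u 1 s y ^ 2) + (γhi / 2) * (w s y - wstar) ^ 2 with hK_def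
  set J : ℝ := ∫ s in (0 : ℝ)..P, ∫ y : EuclideanSpace ℝ (Fin 2),
    Real.smoothTransition (a' + 1 - √(1 + ‖y‖ ^ 2)) * (γlo * (w s y - wstar) ^ 2) with hJ_def
  have hu2 : ContDiff ℝ ∞ (uncurry fun s (y : EuclideanSpace ℝ (Fin 2)) => u 0 s y ^ 2 + u 1 s y ^ 2) :=
    ((hu 0).pow 2).add ((hu 1).pow 2)
  have hd2 : ContDiff ℝ ∞ (uncurry fun s (y : EuclideanSpace ℝ (Fin 2)) => (w s y - wstar) ^ 2) :=
    (hw.sub contDiff_const).pow 2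
  have hKc : Continuous (uncurry K) := (continuous_const.mul hu2.continuous).add (continuous_const.mul hd2.continuous)
  have hK0 : ∀ s y, 0 ≤ K s y := fun s y => by simp only [hK_def]; positivity
  have hJ0 : 0 ≤ J := intervalIntegral.integral_nonneg hP fun s _ => integral_nonneg fun y =>
    mul_nonneg (Real.smoothTransition.nonneg _) (by positivity)
  -- the cutoffs along the radii `a' + 2k + 1` and the shell energies
  set c : ℕ → EuclideanSpace ℝ (Fin 2) → ℝ := fun k y => Real.smoothTransition (a' + 2 * k + 1 - √(1 + ‖y‖ ^ 2)) with hc_def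
  have hcc : ∀ k, Continuous (c k) := fun k => by
    have := continuous_cutoff (a' + 2 * k)
    simpa [hc_def] using this
  have hc0 : ∀ (k : ℕ) (y : EuclideanSpace ℝ (Fin 2)), a' + 2 * (k : ℝ) + 1 < ‖y‖ → c k y = 0 := fun k y hy =>
    Real.smoothTransition.zero_of_nonpos (by linarith [norm_le_bracket y])
  have hcd : ∀ k, Continuous fun y => c (k + 1) y - c k y := fun k => (hcc (k + 1)).sub (hcc k)
  have hcd0 : ∀ (k : ℕ) (y : EuclideanSpace ℝ (Fin 2)), a' + 2 * (k : ℝ) + 3 < ‖y‖ → c (k + 1) y - c k y = 0 := by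
    intro k y hy
    rw [hc0 (k + 1) y (by push_cast; linarith), hc0 k y (by linarith), sub_zero]
  set h : ℕ → ℝ := fun k => ∫ s in (0 : ℝ)..P, ∫ y, (c (k + 1) y - c k y) * K s y with hh_def
  have hhc : ∀ k, Continuous fun s => ∫ y, (c (k + 1) y - c k y) * K s y := fun k => continuous_weighted hKc (hcd k) (hcd0 k)
  -- each shell energy is at least `J / (L (a' + 2k + 2))`
  have hk : ∀ k : ℕ, J / (L * (a' + 2)) * (1 / ((k : ℝ) + 1)) ≤ h k := by
    intro k
    have hak : 0 ≤ a' + 2 * k + 1 := by positivity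
    have hsh := defect_le_shell hu hw hΘs hΘ hΘ0 hγlo hGlo hGhi hus hws hpol hP hPu hPw hL0.le hL ha' (a := a' + 2 * k + 1)
      (by linarith [hak])
    have e1 : ∀ y : EuclideanSpace ℝ (Fin 2),
        a' + 2 * (k : ℝ) + 1 + 2 - √(1 + ‖y‖ ^ 2) = a' + 2 * ((k + 1 : ℕ) : ℝ) + 1 - √(1 + ‖y‖ ^ 2) := fun y => by
      push_cast; ring
    simp only [e1] at hsh
    have hsh' : J ≤ L * (a' + 2 * k + 1 + 1) * h k := hsh
    have hpos : 0 < L * (a' + 2 * k + 1 + 1) := by positivity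
    have h1 : (a' + 2 * k + 1 + 1) ≤ (a' + 2) * ((k : ℝ) + 1) := by nlinarith [(k : ℕ).cast_nonneg (α := ℝ)]
    have hh0 : 0 ≤ h k := by
      refine intervalIntegral.integral_nonneg hP fun s _ => integral_nonneg fun y =>
        mul_nonneg (sub_nonneg.2 (Real.smoothTransition.monotone (by push_cast; linarith))) (hK0 s y)
    rw [div_mul_div_comm, mul_one, div_le_iff₀ (by positivity)]
    calc J ≤ L * (a' + 2 * k + 1 + 1) * h k := hsh'
      _ ≤ L * ((a' + 2) * ((k : ℝ) + 1)) * h k := by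
          exact mul_le_mul_of_nonneg_right (mul_le_mul_of_nonneg_left h1 hL0.le) hh0
      _ = h k * (L * (a' + 2) * ((k : ℝ) + 1)) := by ring
  -- telescoping
  have hlin : ∑ k ∈ Finset.range N, h k = ∫ s in (0 : ℝ)..P, ∫ y, (c N y - c 0 y) * K s y := by
    simp only [hh_def]
    rw [← intervalIntegral.integral_finsetSum fun k _ => (hhc k).intervalIntegrable _ _]
    refine intervalIntegral.integral_congr fun s _ => ?_
    show ∑ k ∈ Finset.range N, ∫ y, (c (k + 1) y - c k y) * K s y = ∫ y, (c N y - c 0 y) * K s y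
    rw [← integral_finsetSum _ fun k _ => integrable_weighted hKc (hcd k) (hcd0 k) s]
    refine integral_congr_ae (Eventually.of_forall fun y => ?_)
    show ∑ k ∈ Finset.range N, (c (k + 1) y - c k y) * K s y = (c N y - c 0 y) * K s y
    rw [← Finset.sum_mul, Finset.sum_range_sub (fun k => c k y)]
  have hNc : Continuous fun s => ∫ y, (c N y - c 0 y) * K s y :=
    continuous_weighted hKc ((hcc N).sub (hcc 0)) (R := a' + 2 * N + 1) fun y hy => by
      show c N y - c 0 y = 0
      rw [hc0 N y hy, hc0 0 y (by push_cast; linarith), sub_zero]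
  have hcNc : Continuous fun s => ∫ y, c N y * K s y := continuous_weighted hKc (hcc N) (hc0 N)
  have hdrop : ∫ s in (0 : ℝ)..P, ∫ y, (c N y - c 0 y) * K s y ≤ ∫ s in (0 : ℝ)..P, ∫ y, c N y * K s y := by
    refine intervalIntegral.integral_mono_on hP (hNc.intervalIntegrable _ _) (hcNc.intervalIntegrable _ _) fun s _ => ?_
    refine integral_mono (integrable_weighted hKc ((hcc N).sub (hcc 0)) (R := a' + 2 * N + 1)
      (fun y hy => by
        show c N y - c 0 y = 0
        rw [hc0 N y hy, hc0 0 y (by push_cast; linarith), sub_zero]) s) (integrable_weighted hKc (hcc N) (hc0 N) s) fun y => ?_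
    have : 0 ≤ c 0 y := Real.smoothTransition.nonneg _
    nlinarith [hK0 s y]
  calc J / (L * (a' + 2)) * ∑ k ∈ Finset.range N, (1 / ((k : ℝ) + 1))
      = ∑ k ∈ Finset.range N, J / (L * (a' + 2)) * (1 / ((k : ℝ) + 1)) := by rw [Finset.mul_sum]
    _ ≤ ∑ k ∈ Finset.range N, h k := Finset.sum_le_sum fun k _ => hk k
    _ = ∫ s in (0 : ℝ)..P, ∫ y, (c N y - c 0 y) * K s y := hlin
    _ ≤ ∫ s in (0 : ℝ)..P, ∫ y, c N y * K s y := hdrop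

end Summit.NavierStokesRegularity.NavierStokesRegularity.Theorems.PoloidalWindowDoorPoloidalWindowRigidityZShockBreatherRadiation

end
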